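import Literature.IUT.LogVolume.TensorPacketModel
import Literature.IUT.LogVolume.TensorPacketLogHolds
import HarnessLib

/-!
# The tensor-packet model with a general log-shell normalisation, and Mochizuki's container
# `p^{−⌈d_I+a_I⌉}·log_p(R_I^×)` as the shell ([IUTchIV] Prop. 1.2 (ii) vs Dupuy–Hilado §4 intro / (4.10))

Dupuy–Hilado, arXiv:2004.13228 (pre-split text) §4 intro (render chunk 13): "`I_{v⃗} = I_{v̲_0} ⊗ ⋯ ⊗ I_{v̲_j}`
… `I_{v̲} = (1/2p_{v̲}) log(O^×_{v̲})`", and (4.10): "`(O_𝕃(−P_Θ))^{Ind3}` … given locally … by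
`(q̲^{j²}_{v̲})^ℕ · Peel^j_{v̲} I^{⊗ j+1}_{V̲}`". [IUTchIV] Prop. 1.2 (ii), "In particular" (kurims p. 10):
"`φ((R_I)^∼) ⊆ p^{−⌈d_I+a_I⌉}·log_p(R_I^×)`" — the container Mochizuki's Thm. 1.10 Step (v) (p. 27–28)
actually measures; since `d_I + a_I ≥ |I|` (Prop. 1.4 (iii) proof; `LogRadiusBounds.card_le_sum_add_logRadiusA`)
it CONTAINS the tensor product of log-shells `(p*)^{−|I|}·log_p(R_I^×) = I_{v⃗}`, strictly when `d_I + a_I > |I|`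
(wild ramification).

WHY THIS FILE. The interface `IndPacketModel` (abc-iut-c312-3 gen 0) has ONE slot `shell` feeding both (Ind2)
(`Aut(V : I_{v⃗})`) and the (Ind3)-bound of `Ind3Datum.subset_bound` ((4.10)). The real model
`realPrimePacket` (`TensorPacketModel.lean`) fills it with Dupuy–Hilado's `I_{v⃗}`. Whether the (Ind3)-datum is
then SATISFIABLE at wildly ramified tuples (it needs `(R_I)^∼ ⊆ I_{v⃗}` at unit slots) is open (cell question
R7-C3-Q1); with Mochizuki's container it is a THEOREM (Prop. 1.2 (ii) with `φ = id`, abc-iut-S6's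
`prop12ii'_holds`). So this file provides, WITHOUT touching the landed model:

* `realPrimePacketWith p 𝔽 c` — the real packet with shell `c(v⃗)·log_p(R_I^×)` for any nonzero, slot-symmetric
  scalar `c`; `realPrimePacketWith_shellScalar : realPrimePacketWith … (2p)^{−|I|} = realPrimePacket` (`rfl`);
  the (Ind2) group is the SAME for every `c` (`Aut(V : c·Λ) = Aut(V : Λ)`), as are all volumes;
* `mShellExp p k := ⌈d_I + a_I⌉`, `realPrimePacketM` / `tensorPacketModelM` — the model with Mochizuki's
  container as shell; `normalizedPacket_subset_mShell` : `(R_I)^∼ ⊆ p^{−⌈d_I+a_I⌉}·log_p(R_I^×)` (|I| ≥ 2), hence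
  `regionOf_subset_iUnion_peel_mShell`: in this model the MINIMAL region `O_𝕃(−P_Θ)_{v⃗} = ι(t)·(R_I)^∼` satisfies
  the (4.10)-shaped bound `⊆ ⋃_n ι(t)^n·shell` (take `n = 1`) for EVERY idele — so a Dupuy–Hilado datum with
  `(O_𝕃(−P_Θ))^{Ind3} := O_𝕃(−P_Θ)` exists (summit-side `LDHTensor`).

[cite: DupuyHilado2025, §4 (intro), §4.10] [cite: Mochizuki2012, IUTchIV Prop. 1.2 (ii) p. 10] Both shells are
named instances; nothing here says which one [IUTchIII] Thm. 3.11 (ii) (Ind3) means. An instance ≠ an endorsement.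
-/

noncomputable section

open MeasureTheory Set Metric NumberField IsDedekindDomain
open scoped TensorProduct NormedField Pointwise ENNReal

namespace Literature.IUT.LogVolume

open Literature.NumberTheory.GaloisRepresentations.Ultrametric

variable {F : Type} [Field F] [NumberField F]

/-! ## Scalar multiples of `log_p(R_I^×)` as shells -/

section Scalar

variable (p : ℕ) [Fact p.Prime] {I : Type} [Fintype I] [DecidableEq I]
variable (k : I → Type) [∀ i, NontriviallyNormedField (k i)] [∀ i, NormedAlgebra ℚ_[p] (k i)]
  [∀ i, IsUltrametricDist (k i)] [∀ i, ProperSpace (k i)]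

omit [Fintype I] [DecidableEq I] [∀ i, IsUltrametricDist (k i)] [∀ i, ProperSpace (k i)] in
/-- (Ind2) preserves every scalar multiple of the lattice: `g·(c·log_p(R_I^×)) = c·log_p(R_I^×)`.
[cite: DupuyHilado2025, §4.9] -/
theorem indTwo_smul_const_smul_logPacket (g : indTwo p k) (c : ℚ_[p]) :
    g • (c • (logPacket p k : Set (PacketAlgebra p k))) = c • (logPacket p k : Set (PacketAlgebra p k)) := by
  rw [indTwo_smul_set, image_const_smul, image_logPacket_of_mem p k g.2]

omit [DecidableEq I] in
/-- `d_I` is symmetric in the slots. [cite: Mochizuki2012, IUTchIV Prop. 1.1 p. 9] -/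
theorem dSum_perm (σ : Equiv.Perm I) : dSum p (fun i => k (σ i)) = dSum p k :=
  Equiv.sum_comp σ (fun i => differentOrd p (k i))

omit [DecidableEq I] in
/-- `a_I` is symmetric in the slots. [cite: Mochizuki2012, IUTchIV Prop. 1.2 p. 10] -/
theorem aSum_perm (σ : Equiv.Perm I) : aSum p (fun i => k (σ i)) = aSum p k :=
  Equiv.sum_comp σ (fun i => logRadiusA p (absRamificationIdx p (k i)))

/-- **Mochizuki's shell exponent** `⌈d_I + a_I⌉` ([IUTchIV] Prop. 1.2 (ii) "In particular").
[cite: Mochizuki2012, IUTchIV Prop. 1.2 (ii) p. 10] -/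
def mShellExp : ℤ := ⌈dSum p k + aSum p k⌉

omit [DecidableEq I] in
/-- `⌈d_I + a_I⌉` is symmetric in the slots. [cite: Mochizuki2012, IUTchIV Prop. 1.2 (ii) p. 10] -/
theorem mShellExp_perm (σ : Equiv.Perm I) : mShellExp p (fun i => k (σ i)) = mShellExp p k := by
  rw [mShellExp, mShellExp, dSum_perm, aSum_perm]

/-- **Mochizuki's container as a shell**: `p^{−⌈d_I+a_I⌉}·log_p(R_I^×)`. [cite: Mochizuki2012, IUTchIV Prop. 1.2 (ii) p. 10] -/
def mShell : Set (PacketAlgebra p k) := ppow p k (-mShellExp p k) • (logPacket p k : Set (PacketAlgebra p k))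

omit [Fintype I] [DecidableEq I] [∀ i, IsUltrametricDist (k i)] [∀ i, ProperSpace (k i)] in
/-- `p^n·A = (p^n : ℚ_p)·A` (the ring translate is the scalar multiple). [folklore] -/
private theorem ppow_smul_eq_const_smul (n : ℤ) (A : Set (PacketAlgebra p k)) :
    ppow p k n • A = ((p : ℚ_[p]) ^ n) • A := by
  rw [ppow, ← smul_set_eq_algebraMap_smul]

omit [DecidableEq I] in
/-- `mShell = (p^{−⌈d_I+a_I⌉} : ℚ_p)·log_p(R_I^×)` as a scalar multiple. [cite: Mochizuki2012, IUTchIV Prop. 1.2 (ii) p. 10] -/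
theorem mShell_eq_const_smul :
    mShell p k = ((p : ℚ_[p]) ^ (-mShellExp p k)) • (logPacket p k : Set (PacketAlgebra p k)) :=
  ppow_smul_eq_const_smul p k _ _

/-- **`(R_I)^∼ ⊆ p^{−⌈d_I+a_I⌉}·log_p(R_I^×)`** for `|I| ≥ 2` — [IUTchIV] Prop. 1.2 (ii) "In particular" with
`φ = id` (abc-iut-S6's `prop12ii'_holds`, abc-iut-S5's Prop. 1.1). [cite: Mochizuki2012, IUTchIV Prop. 1.2 (ii) p. 10] -/
theorem normalizedPacket_subset_mShell (hI : 2 ≤ Fintype.card I) :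
    (normalizedPacket p k : Set (PacketAlgebra p k)) ⊆ mShell p k := by
  obtain ⟨h, hh⟩ := exists_realizesNegB p k
  have h12 := (prop12ii'_holds p k hI (LinearEquiv.refl ℚ_[p] (PacketAlgebra p k)) (isLogPacketAut_refl p k)
    h hh).1
  intro x hx
  exact h12 ⟨x, hx, rfl⟩

/-- Hence every translate `g·(R_I)^∼` lies in `g·shell_M`, the `n = 1` term of `⋃_n g^n·shell_M` — the
(4.10)-SHAPED bound holds for the MINIMAL region in Mochizuki's normalisation, for every `g`.
[cite: Mochizuki2012, IUTchIV Prop. 1.2 (ii) p. 10] -/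
theorem smul_normalizedPacket_subset_iUnion_mShell (hI : 2 ≤ Fintype.card I) (g : PacketAlgebra p k) :
    g • (normalizedPacket p k : Set (PacketAlgebra p k)) ⊆
      ⋃ n : ℕ, (fun x => g * x)^[n] '' mShell p k := by
  intro x hx
  obtain ⟨y, hy, rfl⟩ := hx
  refine Set.mem_iUnion.mpr ⟨1, ?_⟩
  rw [Function.iterate_one]
  exact ⟨y, normalizedPacket_subset_mShell p k hI hy, rfl⟩

end Scalar

/-! ## The real packet with a general shell normalisation -/

section With

variable (p : ℕ) [Fact p.Prime] (𝔽 : LocalFields F p)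
variable (c : (j : ℕ) → (Fin (j + 1) → placesOver F p) → ℚ_[p]) (hc0 : ∀ j e, c j e ≠ 0)
  (hcσ : ∀ (j : ℕ) (σ : Equiv.Perm (Fin (j + 1))) (e : Fin (j + 1) → placesOver F p), c j (e ∘ σ) = c j e)

include hcσ in
/-- (Ind1) carries the shell `c(v⃗∘σ)·log_p(R^×)` of the permuted packet onto `c(v⃗)·log_p(R^×)` (for slot-symmetric
`c`). [cite: DupuyHilado2025, §4.7] -/
theorem image_shellWith_perm {j : ℕ} (σ : Equiv.Perm (Fin (j + 1))) (e : Fin (j + 1) → placesOver F p) :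
    permAlgEquiv p (fun i => 𝔽.k (e i)) σ ''
        (c j (e ∘ σ) • (logPacket p (fun i => 𝔽.k (e (σ i))) : Set (PacketAlgebra p (fun i => 𝔽.k (e (σ i)))))) =
      c j e • (logPacket p (fun i => 𝔽.k (e i)) : Set (PacketAlgebra p (fun i => 𝔽.k (e i)))) := by
  rw [image_const_smul_perm, image_logPacket_perm, hcσ]

/-- **The real packet with shell `c(v⃗)·log_p(R_I^×)`** (every other field as in `realPrimePacket`; the (Ind2)
group `Aut(V : log_p(R_I^×))` does not depend on `c`). [cite: DupuyHilado2025, Def. 3.6.1, §3.7, §4.7, §4.9, §4.12] -/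
def realPrimePacketWith : PrimePacket F p where
  X j e := PacketAlgebra p (fun i => 𝔽.k (e i))
  adm {_ e} A := PacketAdm p (fun i => 𝔽.k (e i)) A
  logμ {_ e} A := packetLogμ p (fun i => 𝔽.k (e i)) A
  logμ_mono {_ e _ _} hA hB h := packetLogμ_mono p (fun i => 𝔽.k (e i)) hA hB h
  O j e := (normalizedPacket p (fun i => 𝔽.k (e i)) : Set (PacketAlgebra p (fun i => 𝔽.k (e i))))
  O_adm j e := packetAdm_normalizedPacket p (fun i => 𝔽.k (e i))
  logμ_O j e := packetLogμ_normalizedPacket p (fun i => 𝔽.k (e i))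
  Λ v := (𝔽.k v)ˣ
  ordv {_} a := 𝔽.ordv a
  peel {j e} a x := iota p (fun i => 𝔽.k (e i)) (Fin.last j) (a : 𝔽.k (e (Fin.last j))) * x
  peel_adm {j e} a U hU := by
    show PacketAdm p (fun i => 𝔽.k (e i)) (iota p (fun i => 𝔽.k (e i)) (Fin.last j) (a : 𝔽.k (e (Fin.last j))) • U)
    exact packetAdm_iota_smul p (fun i => 𝔽.k (e i)) (Fin.last j) a.ne_zero hU
  logμ_peel {j e} a U hU := by
    show packetLogμ p (fun i => 𝔽.k (e i)) (iota p (fun i => 𝔽.k (e i)) (Fin.last j) (a : 𝔽.k (e (Fin.last j))) • U) = _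
    rw [packetLogμ_iota_smul p (fun i => 𝔽.k (e i)) (Fin.last j) a.ne_zero hU, LocalFields.log_norm_eq_neg_ordv]
  shell j e := c j e • (logPacket p (fun i => 𝔽.k (e i)) : Set (PacketAlgebra p (fun i => 𝔽.k (e i))))
  shell_adm j e := packetAdm_const_smul p (fun i => 𝔽.k (e i)) (hc0 j e) (packetAdm_logPacket p _)
  perm {j} σ e := (permAlgEquiv p (fun i => 𝔽.k (e i)) σ).toEquiv
  perm_one {j} e x := permAlgEquiv_one_apply p (fun i => 𝔽.k (e i)) x
  perm_adm {j} σ e U hU := packetAdm_image_perm p (fun i => 𝔽.k (e i)) σ hU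
  logμ_perm {j} σ e U hU := packetLogμ_image_perm p (fun i => 𝔽.k (e i)) σ U
  perm_shell {j} σ e := image_shellWith_perm p 𝔽 c hcσ σ e
  G₂ j e := indTwo p (fun i => 𝔽.k (e i))
  smul_adm {_ e} g U hU := packetAdm_indTwo_smul p (fun i => 𝔽.k (e i)) g hU
  logμ_smul {_ e} g U hU := packetLogμ_indTwo_smul p (fun i => 𝔽.k (e i)) g U
  smul_shell {_ e} g := indTwo_smul_const_smul_logPacket p (fun i => 𝔽.k (e i)) g _
  hullLoc j e := packetHull p (fun i => 𝔽.k (e i))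

/-- **Dupuy–Hilado's normalisation is the case `c = (2p)^{−|I|}`**: `realPrimePacketWith … (2p)^{−(j+1)} =
realPrimePacket` (definitionally). [cite: DupuyHilado2025, §4 (intro)] -/
theorem realPrimePacketWith_shellScalar :
    realPrimePacketWith p 𝔽 (fun j _ => shellScalar p (I := Fin (j + 1))) (fun _ _ => shellScalar_ne_zero p)
      (fun _ _ _ => rfl) = realPrimePacket p 𝔽 := rfl

/-- The shell of the scaled packet. [cite: DupuyHilado2025, §4 (intro)] -/
theorem realPrimePacketWith_shell (j : ℕ) (e : Fin (j + 1) → placesOver F p) :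
    (realPrimePacketWith p 𝔽 c hc0 hcσ).shell j e =
      c j e • (logPacket p (fun i => 𝔽.k (e i)) : Set (PacketAlgebra p (fun i => 𝔽.k (e i)))) := rfl

end With

/-! ## Mochizuki's normalisation: the container of [IUTchIV] Prop. 1.2 (ii) as the shell -/

section Mochizuki

variable (p : ℕ) [Fact p.Prime] (𝔽 : LocalFields F p)

/-- The scalar `p^{−⌈d_I+a_I⌉}` of the summand `v⃗`. [cite: Mochizuki2012, IUTchIV Prop. 1.2 (ii) p. 10] -/
def mScale (j : ℕ) (e : Fin (j + 1) → placesOver F p) : ℚ_[p] :=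
  (p : ℚ_[p]) ^ (-mShellExp p (fun i => 𝔽.k (e i)))

/-- `p^{−⌈d_I+a_I⌉} ≠ 0`. [cite: Mochizuki2012, IUTchIV Prop. 1.2 (ii) p. 10] -/
theorem mScale_ne_zero (j : ℕ) (e : Fin (j + 1) → placesOver F p) : mScale p 𝔽 j e ≠ 0 :=
  zpow_ne_zero _ (by exact_mod_cast (Fact.out : p.Prime).ne_zero)

/-- `p^{−⌈d_I+a_I⌉}` is symmetric in the slots. [cite: Mochizuki2012, IUTchIV Prop. 1.2 (ii) p. 10] -/
theorem mScale_perm (j : ℕ) (σ : Equiv.Perm (Fin (j + 1))) (e : Fin (j + 1) → placesOver F p) :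
    mScale p 𝔽 j (e ∘ σ) = mScale p 𝔽 j e := by
  have h := mShellExp_perm p (fun i => 𝔽.k (e i)) σ
  exact congrArg (fun n : ℤ => (p : ℚ_[p]) ^ (-n)) h

/-- **The real packet with Mochizuki's container as shell**: `shell(v⃗) := p^{−⌈d_I+a_I⌉}·log_p(R_I^×)`.
[cite: Mochizuki2012, IUTchIV Prop. 1.2 (ii) p. 10] -/
def realPrimePacketM : PrimePacket F p :=
  realPrimePacketWith p 𝔽 (mScale p 𝔽) (mScale_ne_zero p 𝔽) (mScale_perm p 𝔽)

/-- Its shell IS `mShell` (the ring translate `p^{−⌈d_I+a_I⌉}·log_p(R_I^×)`). [cite: Mochizuki2012, IUTchIV Prop. 1.2 (ii) p. 10] -/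
theorem realPrimePacketM_shell (j : ℕ) (e : Fin (j + 1) → placesOver F p) :
    (realPrimePacketM p 𝔽).shell j e = mShell p (fun i => 𝔽.k (e i)) := by
  rw [mShell_eq_const_smul]
  rfl

/-- Apart from the shell, `realPrimePacketM` IS `realPrimePacket` (same summands, measures, `O`, scalars, peel,
(Ind1), (Ind2), hull) — e.g. the summand. [cite: DupuyHilado2025, Def. 3.6.1] -/
theorem realPrimePacketM_X (j : ℕ) (e : Fin (j + 1) → placesOver F p) :
    (realPrimePacketM p 𝔽).X j e = PacketAlgebra p (fun i => 𝔽.k (e i)) := rfl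

/-- **In Mochizuki's normalisation the (4.10)-shaped bound holds for the MINIMAL theta region**: for every degree
`j = i+1 ≥ 1` (so `|I| = j+1 ≥ 2`) and every scalar `a ∈ K_{v̲_j}^×`,
`ι_j(a)·(R_I)^∼ ⊆ ⋃_n (ι_j(a)·−)^n(shell_M(v⃗))` (the `n = 1` term suffices).
[cite: Mochizuki2012, IUTchIV Prop. 1.2 (ii) p. 10] -/
theorem peel_normalizedPacket_subset_iUnion_M (i : ℕ) (e : Fin (i + 1 + 1) → placesOver F p)
    (a : (𝔽.k (e (Fin.last (i + 1))))ˣ) :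
    (realPrimePacketM p 𝔽).peel a '' (realPrimePacketM p 𝔽).O (i + 1) e ⊆
      ⋃ n : ℕ, ((realPrimePacketM p 𝔽).peel a)^[n] '' (realPrimePacketM p 𝔽).shell (i + 1) e := by
  rw [realPrimePacketM_shell]
  have hI : 2 ≤ Fintype.card (Fin (i + 1 + 1)) := by simp
  have h := smul_normalizedPacket_subset_iUnion_mShell p (fun i' => 𝔽.k (e i')) hI
    (iota p (fun i' => 𝔽.k (e i')) (Fin.last (i + 1)) (a : 𝔽.k (e (Fin.last (i + 1)))))
  rw [← image_smul] at h
  exact h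

end Mochizuki

/-! ## The model over all primes, Mochizuki's normalisation -/

section ModelM

variable (𝔽 : LocalFieldFamily F)

/-- The tensor-packet model with Mochizuki's shells. [cite: Mochizuki2012, IUTchIV Prop. 1.2 (ii) p. 10] -/
def tensorPacketModelM : IndPacketModel F :=
  IndPacketModel.ofPrimesLine fun p hp => @realPrimePacketM F _ _ p ⟨hp⟩ (𝔽 p hp)

/-- At a prime `p` it IS `realPrimePacketM`. [cite: DupuyHilado2025, Def. 3.6.3] -/
theorem primePart_tensorPacketModelM {p : ℕ} (hp : p.Prime) :
    (tensorPacketModelM 𝔽).primePart p = @realPrimePacketM F _ _ p ⟨hp⟩ (𝔽 p hp) :=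
  IndPacketModel.primePart_ofPrimesLine _ hp

end ModelM

end Literature.IUT.LogVolume

end
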